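import Summits.SmoothPoincare4.SmoothPoincare4.Theorems.CongruenceShadowsShadowApproximationStubLayerStepOneZeroRealisers
import Summits.SmoothPoincare4.SmoothPoincare4.Theorems.CongruenceShadowsShadowApproximationStubLayerStepOneZeroReading
import HarnessLib

/-!
# Helper for stub `stub_layerStepOneZero` (line `nilpotent-genus-class`, crux
`CongruenceShadows.ShadowApproximation`, item stmt-SmoothPoincare4-14595):
# the layer step `(m,c) = (1,0)` from a Goeritz–Johnson certificate

`S = SurfaceGroup 6` (`6 = 3 + 3·1`), `N i = s4Kernels.stabilizeIter 1 i`, `γₖ₊₁ = (⊤).lowerCentralSeries k`.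
`layerStep_of_certificate`: GIVEN a finite family of integer matrices `Mtab i` (inverses `Mitab i`, signs `εtab i`,
handles `ktab i`) passing the decidable Goeritz checks of `exists_goeritz_of_matrix`, and an integer tensor `Q` with
  `RD(Mtab i, Mitab i, ktab i) j v w = Rtab i j v w` (`v < w`) and `∑ᵢ Q a b c i · Rtab i j v w = e_{abc}(j; v, w)`
for all `a < b < c`, `v < w`, `j` (`RD` the closed-form reading of the conjugated seed realiser `yᵢ = xᵢ bp_{kᵢ} xᵢ⁻¹`,
`Rtab` its tabulated values, `e_{abc}` the elementary alternating form) — all DECIDABLE on concrete data, THEN the layer step at `(1,0)` holds: for a kernel triple `K` of genus `6` with `K 0 = N 0`, Waldhausen pairs and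
`K 2 γ₂ = N 2 γ₂` some `y ∈ Stab N₀ ∩ Stab N₁` has `y(N₂ γ₃) = K₂ γ₃` — granted (AUTSYMP) at genus `6`.
Proof: pair normalisation `α' ∈ IA`, `α'(N₂) = K₂` (`exists_ia_of_pair_stabilizeIter`); its reading `D` is alternating
(`reading_ia_g`), hence `D = ∑_{a<b<c} D_{abc} e_{abc}` on `v < w` (`alt_eq_sum_elementary`); the realisers `yᵢ` read as
`RDᵢ` (`exists_conj_realiser`); `y = ∏ᵢ yᵢ ^ nᵢ`, `nᵢ = ∑_{a<b<c} Q a b c i D_{abc}`, lies in `Stab N₀ ∩ Stab N₁` and reads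
as `∑ nᵢ RDᵢ = D` (`reading_list_prod_zpow` + the certificate), so `y(N₂)γ₃ = α'(N₂)γ₃ = K₂γ₃` (`map_sup_eq_of_forms_g`).
No definitions; the data live in the stub file.
-/

set_option linter.dupNamespace false

noncomputable section

open Subgroup Literature.Topology.FourManifolds Literature.Algebra.Lie Multiplicative
open Summit.SmoothPoincare4.SmoothPoincare4.Theorems.NilpotentShadowsStandard.SaturatedTorsorDescent
open scoped commutatorElement

namespace Summit.SmoothPoincare4.SmoothPoincare4.Theorems.ShadowApproximation.NilpotentGenusClass

/-! ## Alternating forms as sums of elementary forms -/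

section Alternating

variable {n : ℕ}

/-- A triple sum with a single non-vanishing term. [folklore] -/
theorem sum3_eq_single (f : Fin n → Fin n → Fin n → ℤ) (a₀ b₀ c₀ : Fin n)
    (h : ∀ a b c, ¬(a = a₀ ∧ b = b₀ ∧ c = c₀) → f a b c = 0) :
    ∑ a, ∑ b, ∑ c, f a b c = f a₀ b₀ c₀ := by
  rw [Finset.sum_eq_single a₀ (fun a _ ha => Finset.sum_eq_zero fun b _ => Finset.sum_eq_zero fun c _ =>
      h a b c fun hh => ha hh.1) (fun hh => (hh (Finset.mem_univ _)).elim),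
    Finset.sum_eq_single b₀ (fun b _ hb => Finset.sum_eq_zero fun c _ => h a₀ b c fun hh => hb hh.2.1)
      (fun hh => (hh (Finset.mem_univ _)).elim),
    Finset.sum_eq_single c₀ (fun c _ hc => h a₀ b₀ c fun hh => hc hh.2.2) (fun hh => (hh (Finset.mem_univ _)).elim)]

/-- **An alternating form is the sum of its values on increasing triples times the elementary alternating forms**
(evaluated at `(j; v < w)`). [folklore] -/
theorem alt_eq_sum_elementary (D : Fin n → Fin n → Fin n → ℤ) (h1 : ∀ a b c, D b a c = -D a b c)
    (h2 : ∀ a b c, D a c b = -D a b c) (j v w : Fin n) (hvw : v < w) :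
    D j v w = ∑ a, ∑ b, ∑ c, if a < b ∧ b < c then D a b c * (if j = a ∧ v = b ∧ w = c then (1 : ℤ) else if j = c ∧ v = a ∧ w = b then (1 : ℤ) else if j = b ∧ v = a ∧ w = c then (-1 : ℤ) else 0) else 0 := by
  have hdiag : ∀ a c, D a a c = 0 := fun a c => by have := h1 a a c; omega
  have hdiag' : ∀ a b, D a b a = 0 := fun a b => by have := h2 a b a; have := hdiag a b; omega
  rcases lt_trichotomy j v with hjv | rfl | hjv
  · -- `j < v < w`: the term `(j, v, w)`
    rw [sum3_eq_single _ j v w]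
    · rw [if_pos ⟨hjv, hvw⟩, if_pos ⟨rfl, rfl, rfl⟩, mul_one]
    · intro a b c hne
      split_ifs with hlt h3 h4 h5 <;> first | rfl | (exfalso; omega) | omega
  · -- `j = v`
    rw [hdiag, eq_comm]
    refine Finset.sum_eq_zero fun a _ => Finset.sum_eq_zero fun b _ => Finset.sum_eq_zero fun c _ => ?_
    split_ifs with hlt h3 h4 h5 <;> first | rfl | (exfalso; omega) | omega
  rcases lt_trichotomy j w with hjw | rfl | hjw
  · -- `v < j < w`: the term `(v, j, w)` with sign `-1`
    rw [sum3_eq_single _ v j w]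
    · rw [if_pos ⟨hjv, hjw⟩, if_neg (by omega), if_neg (by omega), if_pos ⟨rfl, rfl, rfl⟩, h1]; ring
    · intro a b c hne
      split_ifs with hlt h3 h4 h5 <;> first | rfl | (exfalso; omega) | omega
  · -- `j = w`
    rw [hdiag', eq_comm]
    refine Finset.sum_eq_zero fun a _ => Finset.sum_eq_zero fun b _ => Finset.sum_eq_zero fun c _ => ?_
    split_ifs with hlt h3 h4 h5 <;> first | rfl | (exfalso; omega) | omega
  · -- `v < w < j`: the term `(v, w, j)` with sign `+1`
    rw [sum3_eq_single _ v w j]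
    · rw [if_pos ⟨hvw, hjw⟩, if_neg (by omega), if_pos ⟨rfl, rfl, rfl⟩, mul_one]
      have e1 := h2 v j w
      have e2 := h1 j v w
      omega
    · intro a b c hne
      split_ifs with hlt h3 h4 h5 <;> first | rfl | (exfalso; omega) | omega

end Alternating

/-! ## Stabilisers of products -/

section Stabilisers

variable {G : Type*} [Group G]

/-- A list product (in `MulAut G`) of stabilisers of `P` stabilises `P`. [folklore] -/
theorem map_list_prod_eq_of_forall {ι : Type*} (l : List ι) (Φ : ι → MulAut G) (P : Subgroup G)
    (h : ∀ i, P.map (Φ i).toMonoidHom = P) : P.map ((l.map Φ).prod).toMonoidHom = P := by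
  induction l with
  | nil => ext x; simp
  | cons i l ih => rw [List.map_cons, List.prod_cons, MulAut.mul_def, map_trans, ih, h]

end Stabilisers

/-! ## The layer step from a certificate -/

section Certificate

/-- **The layer step `(1,0)` from a Goeritz–Johnson certificate** (see the module docstring). [folklore] -/
theorem layerStep_of_certificate {ι : Type} [Fintype ι] [DecidableEq ι]
    (Mtab Mitab : ι → Matrix (Fin (3 + 3 * 1) × Bool) (Fin (3 + 3 * 1) × Bool) ℤ) (εtab : ι → ℤ)
    (ktab : ι → Fin (3 + 3 * 1)) (Q : Fin (3 + 3 * 1) → Fin (3 + 3 * 1) → Fin (3 + 3 * 1) → ι → ℤ)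
    (hε : ∀ i, εtab i = 1 ∨ εtab i = -1) (hinv : ∀ i, Mtab i * Mitab i = 1) (hinv' : ∀ i, Mitab i * Mtab i = 1)
    (hS : ∀ i (x y : Fin (3 + 3 * 1) × Bool), symplForm (fun k => Mtab i k x) (fun k => Mtab i k y) =
      εtab i * symplForm (Pi.single x (1 : ℤ) : Fin (3 + 3 * 1) × Bool → ℤ) (Pi.single y (1 : ℤ)))
    (h0 : ∀ i (a b : Fin (3 + 3 * 1)), Mtab i (a, !decide ((a : ℕ) % 3 = 2)) (b, decide ((b : ℕ) % 3 = 2)) = 0)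
    (h1 : ∀ i (a b : Fin (3 + 3 * 1)), Mtab i (a, !decide ((a : ℕ) % 3 = 1)) (b, decide ((b : ℕ) % 3 = 1)) = 0)
    (Rtab : ι → Fin (3 + 3 * 1) → Fin (3 + 3 * 1) → Fin (3 + 3 * 1) → ℤ)
    (hRD : ∀ (i : ι) (j v w : Fin (3 + 3 * 1)), v < w → ((if decide (((j : Fin (3 + 3 * 1)) : ℕ) % 3 = 0) then (-1 : ℤ) else 1) * (((∑ x : Fin (3 + 3 * 1) × Bool, (Mitab i) x (j, decide (((j : Fin (3 + 3 * 1)) : ℕ) % 3 = 0)) * (if x.1 = ((ktab i : Fin (3 + 3 * 1)), true).1 ∧ x.2 = false ∧ ((ktab i : Fin (3 + 3 * 1)), true).2 = true then (1 : ℤ) else if x.1 = ((ktab i : Fin (3 + 3 * 1)), true).1 ∧ x.2 = true ∧ ((ktab i : Fin (3 + 3 * 1)), true).2 = false then (-1 : ℤ) else 0)) * ((Mtab i) (v, !decide (((v : Fin (3 + 3 * 1)) : ℕ) % 3 = 0)) ((ktab i : Fin (3 + 3 * 1)), false) * (Mtab i) (w, !decide (((w : Fin (3 + 3 * 1)) :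 ℕ) % 3 = 0)) ((ktab i : Fin (3 + 3 * 1)) + 1, true)) + (∑ x : Fin (3 + 3 * 1) × Bool, (Mitab i) x (j, decide (((j : Fin (3 + 3 * 1)) : ℕ) % 3 = 0)) * (if x.1 = ((ktab i : Fin (3 + 3 * 1)), false).1 ∧ x.2 = false ∧ ((ktab i : Fin (3 + 3 * 1)), false).2 = true then (1 : ℤ) else if x.1 = ((ktab i : Fin (3 + 3 * 1)), false).1 ∧ x.2 = true ∧ ((ktab i : Fin (3 + 3 * 1)), false).2 = false then (-1 : ℤ) else 0)) * ((Mtab i) (v, !decide (((v : Fin (3 + 3 * 1)) : ℕ) % 3 = 0)) ((ktab i : Fin (3 + 3 * 1)) + 1, true) * (Mtab i) (w, !decide (((w : Fin (3 + 3 * 1)) : ℕ) % 3 = 0)) ((ktab i : Fin (3 + 3 * 1)), true)) + (∑ x : Fin (3 + 3 * 1) × Bool, (Mitab i) x (j, decide (((j : Fin (3 + 3 * 1)) : ℕ) % 3 = 0)) * (if x.1 = ((ktab i : Fin (3 + 3 * 1)) + 1, true).1 ∧ x.2 = false ∧ ((ktab i : Fin (3 + 3 * 1)) + 1, true).2 =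 true then (1 : ℤ) else if x.1 = ((ktab i : Fin (3 + 3 * 1)) + 1, true).1 ∧ x.2 = true ∧ ((ktab i : Fin (3 + 3 * 1)) + 1, true).2 = false then (-1 : ℤ) else 0)) * ((Mtab i) (v, !decide (((v : Fin (3 + 3 * 1)) : ℕ) % 3 = 0)) ((ktab i : Fin (3 + 3 * 1)), true) * (Mtab i) (w, !decide (((w : Fin (3 + 3 * 1)) : ℕ) % 3 = 0)) ((ktab i : Fin (3 + 3 * 1)), false))) - ((∑ x : Fin (3 + 3 * 1) × Bool, (Mitab i) x (j, decide (((j : Fin (3 + 3 * 1)) : ℕ) % 3 = 0)) * (if x.1 = ((ktab i : Fin (3 + 3 * 1)), true).1 ∧ x.2 = false ∧ ((ktab i : Fin (3 + 3 * 1)), true).2 = true then (1 : ℤ) else if x.1 = ((ktab i : Fin (3 + 3 * 1)), true).1 ∧ x.2 = true ∧ ((ktab i : Fin (3 + 3 * 1)), true).2 = false then (-1 : ℤ) else 0)) * ((Mtab i) (w, !decide (((w : Fin (3 + 3 * 1)) : ℕ) % 3 = 0)) ((ktab i : Fin (3 + 3 * 1)), false) * (Mtab i) (v, !decide (((v : Fin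 (3 + 3 * 1)) : ℕ) % 3 = 0)) ((ktab i : Fin (3 + 3 * 1)) + 1, true)) + (∑ x : Fin (3 + 3 * 1) × Bool, (Mitab i) x (j, decide (((j : Fin (3 + 3 * 1)) : ℕ) % 3 = 0)) * (if x.1 = ((ktab i : Fin (3 + 3 * 1)), false).1 ∧ x.2 = false ∧ ((ktab i : Fin (3 + 3 * 1)), false).2 = true then (1 : ℤ) else if x.1 = ((ktab i : Fin (3 + 3 * 1)), false).1 ∧ x.2 = true ∧ ((ktab i : Fin (3 + 3 * 1)), false).2 = false then (-1 : ℤ) else 0)) * ((Mtab i) (w, !decide (((w : Fin (3 + 3 * 1)) : ℕ) % 3 = 0)) ((ktab i : Fin (3 + 3 * 1)) + 1, true) * (Mtab i) (v, !decide (((v : Fin (3 + 3 * 1)) : ℕ) % 3 = 0)) ((ktab i : Fin (3 + 3 * 1)), true)) + (∑ x : Fin (3 + 3 * 1) × Bool, (Mitab i) x (j, decide (((j : Fin (3 + 3 * 1)) : ℕ) % 3 = 0)) * (if x.1 = ((ktab i : Fin (3 + 3 * 1)) + 1, true).1 ∧ x.2 = false ∧ ((ktab i : Fin (3 + 3 *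 1)) + 1, true).2 = true then (1 : ℤ) else if x.1 = ((ktab i : Fin (3 + 3 * 1)) + 1, true).1 ∧ x.2 = true ∧ ((ktab i : Fin (3 + 3 * 1)) + 1, true).2 = false then (-1 : ℤ) else 0)) * ((Mtab i) (w, !decide (((w : Fin (3 + 3 * 1)) : ℕ) % 3 = 0)) ((ktab i : Fin (3 + 3 * 1)), true) * (Mtab i) (v, !decide (((v : Fin (3 + 3 * 1)) : ℕ) % 3 = 0)) ((ktab i : Fin (3 + 3 * 1)), false))))) = Rtab i j v w)
    (hQ : ∀ (a b c j v w : Fin (3 + 3 * 1)), a < b → b < c → v < w → ∑ i, Q a b c i * Rtab i j v w = (if j = a ∧ v = b ∧ w = c then (1 : ℤ) else if j = c ∧ v = a ∧ w = b then (1 : ℤ) else if j = b ∧ v = a ∧ w = c then (-1 : ℤ) else 0))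
    (hA : ∀ (φ : (SurfaceGroup (3 + 3 * 1)) ≃* (SurfaceGroup (3 + 3 * 1))), ∃ (F : (surfaceGen (3 + 3 * 1) → ℤ) ≃ₗ[ℤ] (surfaceGen (3 + 3 * 1) → ℤ)) (ε : ℤ),
      (ε = 1 ∨ ε = -1) ∧ (∀ s : (SurfaceGroup (3 + 3 * 1)), toAdd (SurfaceGroup.abelianize (3 + 3 * 1) (φ s)) =
        F (toAdd (SurfaceGroup.abelianize (3 + 3 * 1) s))) ∧
        ∀ u v : surfaceGen (3 + 3 * 1) → ℤ, symplForm (F u) (F v) = ε * symplForm u v)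
    (K : TrisectionKernels (3 + 3 * 1)) (hK0 : K 0 = s4Kernels.stabilizeIter 1 0)
    (hW : ∀ i j : Fin 3, i ≠ j → ∃ α : (SurfaceGroup (3 + 3 * 1)) ≃* (SurfaceGroup (3 + 3 * 1)),
      (s4Kernels.stabilizeIter 1 i).map α.toMonoidHom = K i ∧ (s4Kernels.stabilizeIter 1 j).map α.toMonoidHom = K j)
    (hK2 : K 2 ⊔ ((⊤ : Subgroup (SurfaceGroup (3 + 3 * 1))).lowerCentralSeries 1) = s4Kernels.stabilizeIter 1 2 ⊔ ((⊤ : Subgroup (SurfaceGroup (3 + 3 * 1))).lowerCentralSeries 1)) :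
    ∃ y : (SurfaceGroup (3 + 3 * 1)) ≃* (SurfaceGroup (3 + 3 * 1)),
      (s4Kernels.stabilizeIter 1 0).map y.toMonoidHom = s4Kernels.stabilizeIter 1 0 ∧
      (s4Kernels.stabilizeIter 1 1).map y.toMonoidHom = s4Kernels.stabilizeIter 1 1 ∧
      (s4Kernels.stabilizeIter 1 2 ⊔ ((⊤ : Subgroup (SurfaceGroup (3 + 3 * 1))).lowerCentralSeries 2)).map y.toMonoidHom = K 2 ⊔ ((⊤ : Subgroup (SurfaceGroup (3 + 3 * 1))).lowerCentralSeries 2) := by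
  classical
  -- (1) pair normalisation from the pair `(0, 2)`
  obtain ⟨α, hα0, hα2⟩ := hW 0 2 (by decide)
  rw [hK0] at hα0
  obtain ⟨α', hα'IA, hα'2⟩ := exists_ia_of_pair_stabilizeIter (m := 1) hA hα0 hα2 hK2
  -- (2) the cut dictionary of slot `2` (cut letters `bⱼ` on `j ≡ 0`, `aⱼ` elsewhere)
  obtain ⟨ct, π, hct, hπs, hπker, hπof⟩ := helper_glueErasePi 1 2 (stub_cutNormalForm 1 2)
  have hctf : ct = fun h : Fin (3 + 3 * 1) => decide ((h : ℕ) % 3 = 0) := by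
    funext h
    have hm : (h, decide ((((h : ℕ)) + ((2 : Fin 3) : ℕ)) % 3 = 2)) ∈ s4CutSystem 1 2 := by
      rw [s4CutSystem_eq_range]; exact ⟨h, rfl⟩
    rw [← (hct h _).1 hm]
    simp only [Fin.val_two]
    by_cases hh : (h : ℕ) % 3 = 0
    · rw [decide_eq_true hh, decide_eq_true (by omega)]
    · rw [decide_eq_false hh, decide_eq_false (by omega)]
  subst hctf
  -- (3) the reading of `α'`
  obtain ⟨Dα, hDα1, hDα2, hDα⟩ := reading_ia_g hπs hπker hπof α' hα'IA
  -- (4) the realisers and their readings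
  have hreal := fun i => exists_conj_realiser (ktab i) (Mtab i) (Mitab i) (εtab i) (hε i) (hinv i) (hinv' i) (hS i) (h0 i)
    (h1 i) hπs hπof
  choose Y hY0 hY1 hYIA hYD using hreal
  -- (5) the exponents and the product realiser
  set nexp : ι → ℤ := fun i => ∑ a, ∑ b, ∑ c, if a < b ∧ b < c then Q a b c i * Dα a b c else 0 with hnexp
  obtain ⟨hyIA, hyD⟩ := reading_list_prod_zpow (Finset.univ.toList) Y nexp hYIA _ hYD
  refine ⟨((Finset.univ.toList).map fun i => ((Y i : MulAut (SurfaceGroup (3 + 3 * 1))) ^ nexp i : MulAut (SurfaceGroup (3 + 3 * 1)))).prod,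
    map_list_prod_eq_of_forall _ _ _ fun i => map_zpow_eq_of_map_eq (Y i) (hY0 i) _,
    map_list_prod_eq_of_forall _ _ _ fun i => map_zpow_eq_of_map_eq (Y i) (hY1 i) _, ?_⟩
  -- (6) equal readings: the certificate
  have heq : ∀ j v w : Fin (3 + 3 * 1), v < w →
      ((Finset.univ.toList).map fun i => nexp i * ((if decide (((j : Fin (3 + 3 * 1)) : ℕ) % 3 = 0) then (-1 : ℤ) else 1) * (((∑ x : Fin (3 + 3 * 1) × Bool, (Mitab i) x (j, decide (((j : Fin (3 + 3 * 1)) : ℕ) % 3 = 0)) * (if x.1 = ((ktab i : Fin (3 + 3 * 1)), true).1 ∧ x.2 = false ∧ ((ktab i : Fin (3 + 3 * 1)), true).2 = true then (1 : ℤ) else if x.1 = ((ktab i : Fin (3 + 3 * 1)), true).1 ∧ x.2 = true ∧ ((ktab i : Fin (3 + 3 * 1)), true).2 = false then (-1 : ℤ) else 0)) * ((Mtab i) (v, !decide (((v : Fin (3 + 3 * 1)) : ℕ) % 3 = 0)) ((ktab i : Fin (3 + 3 * 1)), false) * (Mtab i) (w, !decide (((w : Fin (3 + 3 * 1)) : ℕ)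 % 3 = 0)) ((ktab i : Fin (3 + 3 * 1)) + 1, true)) + (∑ x : Fin (3 + 3 * 1) × Bool, (Mitab i) x (j, decide (((j : Fin (3 + 3 * 1)) : ℕ) % 3 = 0)) * (if x.1 = ((ktab i : Fin (3 + 3 * 1)), false).1 ∧ x.2 = false ∧ ((ktab i : Fin (3 + 3 * 1)), false).2 = true then (1 : ℤ) else if x.1 = ((ktab i : Fin (3 + 3 * 1)), false).1 ∧ x.2 = true ∧ ((ktab i : Fin (3 + 3 * 1)), false).2 = false then (-1 : ℤ) else 0)) * ((Mtab i) (v, !decide (((v : Fin (3 + 3 * 1)) : ℕ) % 3 = 0)) ((ktab i : Fin (3 + 3 * 1)) + 1, true) * (Mtab i) (w, !decide (((w : Fin (3 + 3 * 1)) : ℕ) % 3 = 0)) ((ktab i : Fin (3 + 3 * 1)), true)) + (∑ x : Fin (3 + 3 * 1) × Bool, (Mitab i) x (j, decide (((j : Fin (3 + 3 * 1)) : ℕ) % 3 = 0)) * (if x.1 = ((ktab i : Fin (3 + 3 * 1)) + 1, true).1 ∧ x.2 = false ∧ ((ktab i : Fin (3 + 3 * 1)) + 1, true).2 = true then (1 :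 ℤ) else if x.1 = ((ktab i : Fin (3 + 3 * 1)) + 1, true).1 ∧ x.2 = true ∧ ((ktab i : Fin (3 + 3 * 1)) + 1, true).2 = false then (-1 : ℤ) else 0)) * ((Mtab i) (v, !decide (((v : Fin (3 + 3 * 1)) : ℕ) % 3 = 0)) ((ktab i : Fin (3 + 3 * 1)), true) * (Mtab i) (w, !decide (((w : Fin (3 + 3 * 1)) : ℕ) % 3 = 0)) ((ktab i : Fin (3 + 3 * 1)), false))) - ((∑ x : Fin (3 + 3 * 1) × Bool, (Mitab i) x (j, decide (((j : Fin (3 + 3 * 1)) : ℕ) % 3 = 0)) * (if x.1 = ((ktab i : Fin (3 + 3 * 1)), true).1 ∧ x.2 = false ∧ ((ktab i : Fin (3 + 3 * 1)), true).2 = true then (1 : ℤ) else if x.1 = ((ktab i : Fin (3 + 3 * 1)), true).1 ∧ x.2 = true ∧ ((ktab i : Fin (3 + 3 * 1)), true).2 = false then (-1 : ℤ) else 0)) * ((Mtab i) (w, !decide (((w : Fin (3 + 3 * 1)) : ℕ) % 3 = 0)) ((ktab i : Fin (3 + 3 * 1)), false) * (Mtab i) (v, !decide (((v : Fin (3 +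 3 * 1)) : ℕ) % 3 = 0)) ((ktab i : Fin (3 + 3 * 1)) + 1, true)) + (∑ x : Fin (3 + 3 * 1) × Bool, (Mitab i) x (j, decide (((j : Fin (3 + 3 * 1)) : ℕ) % 3 = 0)) * (if x.1 = ((ktab i : Fin (3 + 3 * 1)), false).1 ∧ x.2 = false ∧ ((ktab i : Fin (3 + 3 * 1)), false).2 = true then (1 : ℤ) else if x.1 = ((ktab i : Fin (3 + 3 * 1)), false).1 ∧ x.2 = true ∧ ((ktab i : Fin (3 + 3 * 1)), false).2 = false then (-1 : ℤ) else 0)) * ((Mtab i) (w, !decide (((w : Fin (3 + 3 * 1)) : ℕ) % 3 = 0)) ((ktab i : Fin (3 + 3 * 1)) + 1, true) * (Mtab i) (v, !decide (((v : Fin (3 + 3 * 1)) : ℕ) % 3 = 0)) ((ktab i : Fin (3 + 3 * 1)), true)) + (∑ x : Fin (3 + 3 * 1) × Bool, (Mitab i) x (j, decide (((j : Fin (3 + 3 * 1)) : ℕ) % 3 = 0)) * (if x.1 = ((ktab i : Fin (3 + 3 * 1)) + 1, true).1 ∧ x.2 = false ∧ ((ktab i : Fin (3 + 3 * 1)) +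 1, true).2 = true then (1 : ℤ) else if x.1 = ((ktab i : Fin (3 + 3 * 1)) + 1, true).1 ∧ x.2 = true ∧ ((ktab i : Fin (3 + 3 * 1)) + 1, true).2 = false then (-1 : ℤ) else 0)) * ((Mtab i) (w, !decide (((w : Fin (3 + 3 * 1)) : ℕ) % 3 = 0)) ((ktab i : Fin (3 + 3 * 1)), true) * (Mtab i) (v, !decide (((v : Fin (3 + 3 * 1)) : ℕ) % 3 = 0)) ((ktab i : Fin (3 + 3 * 1)), false)))))).sum = Dα j v w := by
    intro j v w hvw
    rw [Finset.sum_map_toList, alt_eq_sum_elementary Dα hDα1 hDα2 j v w hvw,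
      Finset.sum_congr rfl fun i _ => by rw [hRD i j v w hvw]]
    simp only [hnexp, Finset.sum_mul]
    rw [Finset.sum_comm]
    refine Finset.sum_congr rfl fun a _ => ?_
    rw [Finset.sum_comm]
    refine Finset.sum_congr rfl fun b _ => ?_
    rw [Finset.sum_comm]
    refine Finset.sum_congr rfl fun c _ => ?_
    by_cases habc : a < b ∧ b < c
    · simp only [if_pos habc]
      rw [← hQ a b c j v w habc.1 habc.2 hvw, Finset.mul_sum]
      exact Finset.sum_congr rfl fun i _ => by ring
    · simp only [if_neg habc, zero_mul, Finset.sum_const_zero]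
  rw [map_sup_eq_of_forms_g hct hπs hπker hπof _ α' hyIA hα'IA _ Dα hyD hDα heq, hα'2]

end Certificate

/-! ## Registered helper -/

/-- **Registered helper `helper_altFormElementary`** (sub-goal of stub `stub_layerStepOneZero`, crux stmt-SmoothPoincare4-14595;
the file's main theorem `layerStep_of_certificate` exceeds the registry's signature size): an alternating integer 3-form is the
sum of its values on increasing triples times the elementary alternating forms, evaluated at `(j; v < w)`. [folklore] -/
theorem helper_altFormElementary : ∀ (n : ℕ) (D : Fin n → Fin n → Fin n → ℤ), (∀ a b c : Fin n, D b a c = -D a b c) → (∀ a b c : Fin n, D a c b = -D a b c) → ∀ (j v w : Fin n), v < w → D j v w = ∑ a : Fin n, ∑ b : Fin n, ∑ c : Fin n, if a < b ∧ b < c then D a b c * (if j = a ∧ v = b ∧ w = c then (1 : ℤ) else if j = c ∧ v = a ∧ w = b then (1 : ℤ) else if j = b ∧ v = a ∧ w = c then (-1 : ℤ) else 0) else 0 :=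
  fun _ D h1 h2 j v w hvw => alt_eq_sum_elementary D h1 h2 j v w hvw

end Summit.SmoothPoincare4.SmoothPoincare4.Theorems.ShadowApproximation.NilpotentGenusClass

end
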